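import Mathlib
import HarnessLib
import Literature.NumberTheory.GaloisRepresentations.GaloisRep
import Literature.NumberTheory.GaloisRepresentations.ContinuousRep
import Literature.NumberTheory.GaloisRepresentations.IntegralGaloisActionProofs
import Literature.NumberTheory.GaloisRepresentations.CarayolSerreLemmasProofs
import Literature.NumberTheory.FaltingsSerre.Criterion

/-!
# The effective Faltings–Serre criterion for `GSp₄` at `ℓ = 2` over `ℚ`
# (Brumer–Pacetti–Poor–Tornaría–Voight–Yuen, Algorithm 2.4.1 / Theorem 2.1.5)

A NAMED FACT (`def … : Prop`, cited, not proved here): the correctness statement of the general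
Faltings–Serre method of [BrumerEtAl2019, §2], specialised to the case used for the paramodularity
certificates of [BrumerEtAl2019, §7]: base field `F = ℚ`, prime `ℓ = 2`, group `G = GSp₄ ≤ GL₄`,
the two representations having the SAME similitude character (in §7 both are the cyclotomic
character), so that the deviation cocycle lives in
`𝔰𝔭₄(𝔽₂) = {a ∈ M₄(𝔽₂) : aᵀJ + Ja = 0}` (`= Lie⁰(GSp₄)(𝔽₂)`, [BrumerEtAl2019, (5.1)]).

## What is printed (Algebra & Number Theory 13:5 (2019), §2; verbatim in the cell's STATEMENTS.md)
* Def 2.1.1: `ρ₁ ≃ ρ₂` iff `∃ g ∈ GL_n(ℤ_ℓ), ρ₁(σ) = g ρ₂(σ) g⁻¹` for all `σ`.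
* Thm 2.1.5: a deterministic algorithm decides `ρ₁ ≃ ρ₂`, for `ρ₁, ρ₂ : Gal_{F,S} → G(ℤ_ℓ)`
  trace computable with `ρ̄₁, ρ̄₂` absolutely irreducible; it is Algorithm 2.4.1:
  (1) test `ρ̄₁ ≃ ρ̄₂` (Alg 2.2.3), let `K` be the fixed field of the common `ρ̄`; (2) enumerate the
  `ℓ`-elementary abelian `L ⊇ K` unramified away from `S` with `Gal(L|F) ↪ (Lie(G) ⋊ G)(𝔽_ℓ)`;
  (3) find all obstructing pairs `(L, φ)` extending `(K, ρ̄)` up to conjugation by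
  `(M_n ⋊ GL_n)(𝔽_ℓ)`; (4) for each, a prime `𝔭 ∉ S` with `utr φ(Frob_𝔭) ≢ 0 (mod ℓ)`;
  (5) if `tr ρ₁(Frob_𝔭) = tr ρ₂(Frob_𝔭)` for the primes of (4), return `ρ₁ ≃ ρ₂`.
  Remark 2.4.2: "if we know that `det ρ₁ = det ρ₂`, then we can replace `Lie(G)` by `Lie⁰(G)`"
  (Lemma 2.3.20), and (5.1): `Lie⁰(GSp₄)(𝔽₂) = 𝔰𝔭₄(𝔽₂) ≃ 𝔽₂^{10}`.
* (2.3.8), Lemma 2.3.11, (2.3.13), Defs 2.3.17/2.3.18: `M_n ⋊ GL_n ↪ GL_{2n}`,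
  `(a,g) ↦ (g ag; 0 g)`; `utr` = trace of the upper right block, a class function; a pair `(L,φ)`
  EXTENDS `(K,ρ̄)` if `φ : Gal_{F,S} → (Lie(G) ⋊ G)(𝔽_ℓ)` is a representation with fixed field `L`
  and `π ∘ φ = ρ̄` — equivalently (Prop 2.3.14(a)) `φ = φ_μ : σ ↦ (ρ̄σ  μ(σ)ρ̄σ; 0  ρ̄σ)` for a
  1-cocycle `μ(στ) = μ(σ) + ρ̄(σ)μ(τ)ρ̄(σ)⁻¹`; it is OBSTRUCTING if `utr φ ≢ 0 (mod ℓ)`, and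
  `utr φ_μ(σ) = tr(μ(σ)ρ̄(σ))` (2.3.15).
* Proof of correctness (after Alg 2.4.1): if `ρ₁ ≄ ρ₂`, take `r ≥ 1` with `ρ₁ ≃ ρ₂ (mod ℓ^r)`,
  `ρ₁ ≄ ρ₂ (mod ℓ^{r+1})`, conjugate so that `ρ₁ ≡ ρ₂ (mod ℓ^r)`, define `μ` by
  `ρ₁(σ) ≡ (1 + ℓ^r μ(σ))ρ₂(σ) (mod ℓ^{r+1})` (2.3.5); by Lemma 2.3.6 `μ` is not a coboundary, so
  by Cor 2.3.19 (which uses Carayol, Thm 2.1.4) `φ_μ` is an obstructing pair unramified outside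
  `S`; the prime of Step 4 for it has `utr φ_μ(Frob_𝔭) ≡ (tr ρ₁ − tr ρ₂)(Frob_𝔭)/ℓ^r ≢ 0`
  (2.3.15), contradicting Step 5.

## The typed statement (`BrumerEtAl2019.faltingsSerre_GSp4_two`) and its faithfulness
Data: a finite set `S` of rational primes with `2 ∈ S`; `ρ₁ ρ₂ : Gal_ℚ →ₜ* GL₄(ℤ₂)` (the tree's
`FramedGaloisRep ℚ ℤ_[2] 4`), both unramified at every prime outside `S`, symplectic similitudes
for the block form `J` below WITH THE SAME MULTIPLIER at every `σ` (this implies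
`det ρ₁ = det ρ₂ = ν²`; it is what holds in §7, and it makes `ρ₁(σ)ρ₂(σ)⁻¹ ∈ Sp₄(ℤ₂)`, whence
the deviation cocycle is `𝔰𝔭₄(𝔽₂)`-valued by `(1+2^r m)ᵀJ(1+2^r m) = J ⇒ mᵀJ + Jm ≡ 0 (mod 2)`
— we do not transcribe the weaker printed hypothesis `det ρ₁ = det ρ₂` of Remark 2.4.2, under
which at `ℓ = 2` the multipliers may differ by a quadratic character); a common reduction
`ρ̄ : Gal_ℚ →ₜ* GL₄(𝔽₂)` (`ρ̄(σ) = ρᵢ(σ) mod 2` literally for both `i` — Step 1 of the algorithm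
conjugates `ρ₂` to achieve this, and Def 2.1.1's `≃` is conjugation-invariant) which is absolutely
irreducible (tree `FramedRep.IsAbsolutelyIrreducible`); a finite set `P` of primes disjoint from
`S`. Hypotheses: (H1) for every continuous 1-cocycle `a : Gal_ℚ → 𝔰𝔭₄(𝔽₂)` for `ad ρ̄` which is
unramified outside `S` (vanishes on the inertia groups above every prime `p ∉ S`) and obstructing
(`tr(a(σ)ρ̄(σ)) ≠ 0` for some `σ`), some `p ∈ P` is an OBSTRUCTING PRIME for it:
`tr(a(σ)ρ̄(σ)) ≠ 0` for every arithmetic Frobenius `σ` at every prime above `p` (well defined: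
`φ_a` is unramified at `p` and `utr` is a class function); (H2) `tr ρ₁(σ) = tr ρ₂(σ)` for every
arithmetic Frobenius `σ` above every `p ∈ P`. Conclusion: `∃ g ∈ GL₄(ℤ₂), ∀ σ, ρ₁σ = g ρ₂σ g⁻¹`.
(H1) is the content of Steps 2–4 for the list `P` (stated for ALL cocycles rather than up to
conjugation — equivalent, `utr` being conjugation-invariant, Lemma 2.3.11), (H2) is Step 5.
The form `J`: §4.2 writes `J = (0 1; −1 0)` in `2 × 2` blocks; (5.1) uses the anti-identity over
`𝔽₂` (the same up to the coordinate swap `e₃ ↔ e₄`); any perfect alternating form on `ℤ₂⁴` is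
`GL₄(ℤ₂)`-equivalent to `J`, and the conclusion is `GL₄(ℤ₂)`-conjugacy, so nothing depends on it.
-- TODO(general form): arbitrary `F`, `ℓ`, `G` and `Lie(G)` (BPPTVY Thm 2.1.5 in full); the
-- residual test Alg 2.2.3 (Step 1); `ℓ` odd.
-/

namespace Literature.NumberTheory.GaloisRepresentations

open IsDedekindDomain NumberField Field

namespace BrumerEtAl2019

/-- The alternating form `J = (0 1; -1 0)` in `2 × 2` blocks (coordinates `0,1 | 2,3`) defining
`GSp₄(R) = {g : gᵀ J g = ν J, ν ∈ Rˣ}` [BrumerEtAl2019, §4.2; cf. (5.1) over `𝔽₂` with the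
anti-identity matrix, which differs by the swap `e₃ ↔ e₄`]. [cite: BrumerEtAl2019, §4.2] -/
def J4 (R : Type*) [CommRing R] : Matrix (Fin 4) (Fin 4) R :=
  !![0, 0, 1, 0; 0, 0, 0, 1; -1, 0, 0, 0; 0, -1, 0, 0]

/-- `ρ₁(σ), ρ₂(σ) ∈ GSp₄(ℤ₂)` with the SAME similitude `ν(σ)`: `ρᵢ(σ)ᵀ J ρᵢ(σ) = ν(σ) J`
(`i = 1, 2`). In [BrumerEtAl2019, §7] both `ρ_{A,2}` ((4.1.3), Weil pairing) and `ρ_{f,2}`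
(Thm 4.3.4(ii), `k = 2`) have similitude the cyclotomic character. [cite: BrumerEtAl2019, §2.1] -/
def HaveSameSimilitude (ρ₁ ρ₂ : FramedGaloisRep ℚ ℤ_[2] 4) : Prop :=
  ∀ σ, ∃ ν : ℤ_[2]ˣ,
    ((ρ₁ σ).val).transpose * J4 ℤ_[2] * (ρ₁ σ).val = (ν : ℤ_[2]) • J4 ℤ_[2] ∧
      ((ρ₂ σ).val).transpose * J4 ℤ_[2] * (ρ₂ σ).val = (ν : ℤ_[2]) • J4 ℤ_[2]

/-- The Lie algebra `𝔰𝔭₄(𝔽₂) = {a ∈ M₄(𝔽₂) : aᵀJ + Ja = 0}` (`= Lie⁰(GSp₄)(𝔽₂) ≃ 𝔽₂^{10}`,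
[BrumerEtAl2019, (5.1)], there with the anti-identity `J`), in which the deviation cocycle of two
symplectic representations with the same similitude takes its values.
[cite: BrumerEtAl2019, (5.1)] -/
def IsSp4Lie (a : Matrix (Fin 4) (Fin 4) (ZMod 2)) : Prop :=
  a.transpose * J4 (ZMod 2) + J4 (ZMod 2) * a = 0

/-- A **continuous 1-cocycle `a` of `Gal_ℚ` for `ad ρ̄` with values in `𝔰𝔭₄(𝔽₂)`**: the datum of
a pair `(L, φ)` extending `(K, ρ̄)` with `φ = φ_a : Gal_ℚ → (𝔰𝔭₄(𝔽₂) ⋊ G) ≤ GL₈(𝔽₂)`,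
`σ ↦ (ρ̄σ  a(σ)ρ̄σ; 0  ρ̄σ)` [BrumerEtAl2019, (2.3.13), Def 2.3.17; Prop 2.3.14(a): `φ_a` is a
homomorphism iff `a(στ) = a(σ) + ρ̄(σ) a(τ) ρ̄(σ)⁻¹`]; `L` is the fixed field of `ker φ_a`, and
continuity of `a` (`𝔽₂` discrete) is continuity of `φ_a`. [cite: BrumerEtAl2019, Def 2.3.17] -/
structure IsExtendingCocycle (ρbar : FramedGaloisRep ℚ (ZMod 2) 4)
    (a : absoluteGaloisGroup ℚ → Matrix (Fin 4) (Fin 4) (ZMod 2)) : Prop where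
  continuous : Continuous a
  cocycle : ∀ σ τ : absoluteGaloisGroup ℚ,
    a (σ * τ) = a σ + (ρbar σ).val * a τ * ((ρbar σ)⁻¹).val
  mem_sp4 : ∀ σ, IsSp4Lie (a σ)

/-- The **upper trace** of `φ_a` at `σ`: `utr φ_a(σ) = tr(a(σ) ρ̄(σ))`, the trace of the upper
right block of `(ρ̄σ  a(σ)ρ̄σ; 0  ρ̄σ)` [BrumerEtAl2019, Lemma 2.3.11 and (2.3.15)].
[cite: BrumerEtAl2019, Lemma 2.3.11] -/
noncomputable def utr (ρbar : FramedGaloisRep ℚ (ZMod 2) 4)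
    (a : absoluteGaloisGroup ℚ → Matrix (Fin 4) (Fin 4) (ZMod 2)) (σ : absoluteGaloisGroup ℚ) :
    ZMod 2 :=
  Matrix.trace (a σ * (ρbar σ).val)

/-- The pair `(L, φ_a)` is **unramified away from `S`** as far as `a` is concerned: `a` vanishes
on every inertia group `I_𝔓 ≤ Gal_ℚ` above every rational prime `p ∉ S` (together with `ρ̄`
unramified there, `φ_a(I_𝔓) = 1`, i.e. `L` is unramified at `p`) — the fields `L` of Step 2 of
Algorithm 2.4.1. Same shape as the tree's `FramedGaloisRep.IsUnramifiedAt`.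
[cite: BrumerEtAl2019, Alg 2.4.1] -/
def IsCocycleUnramifiedOutside (S : Finset ℕ)
    (a : absoluteGaloisGroup ℚ → Matrix (Fin 4) (Fin 4) (ZMod 2)) : Prop :=
  ∀ p : ℕ, p.Prime → p ∉ S → ∀ v : HeightOneSpectrum (𝓞 ℚ), ((p : ℕ) : 𝓞 ℚ) ∈ v.asIdeal →
    ∀ 𝔓 ∈ v.primesAbove, ∀ σ ∈ 𝔓.inertia (absoluteGaloisGroup ℚ), a σ = 0

/-- `ρ : Gal_ℚ →ₜ* GLₙ(A)` is unramified at (every finite place above) every rational prime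
`p ∉ S`, i.e. `ρ` factors through `Gal_{ℚ,S}` [BrumerEtAl2019, §2.1: "`ρ : Gal_{F,S} → GL_n`"].
[cite: BrumerEtAl2019, §2.1] -/
def IsUnramifiedOutsidePrimes (S : Finset ℕ) {A : Type*} [CommRing A] [TopologicalSpace A]
    {n : ℕ} (ρ : FramedGaloisRep ℚ A n) : Prop :=
  ∀ p : ℕ, p.Prime → p ∉ S → ∀ v : HeightOneSpectrum (𝓞 ℚ), ((p : ℕ) : 𝓞 ℚ) ∈ v.asIdeal →
    ρ.IsUnramifiedAt v

/-- **The effective Faltings–Serre criterion of [BrumerEtAl2019] for `GSp₄`, `ℓ = 2`, `F = ℚ`,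
equal similitudes** (correctness of Algorithm 2.4.1 = the proof of Theorem 2.1.5, run with
`Lie⁰(GSp₄)(𝔽₂) = 𝔰𝔭₄(𝔽₂)` as in Remark 2.4.2 and (5.1)). For `ρ₁, ρ₂ : Gal_ℚ →ₜ* GL₄(ℤ₂)`
with values in `GSp₄(ℤ₂)` and the same similitude at every `σ`, unramified outside a finite set
of primes `S ∋ 2`, reducing LITERALLY to the same `ρ̄ : Gal_ℚ →ₜ* GL₄(𝔽₂)`, `ρ̄` absolutely
irreducible; and a finite set of primes `P` disjoint from `S` such that (H1) every obstructing
continuous `𝔰𝔭₄(𝔽₂)`-valued 1-cocycle for `ad ρ̄` unramified outside `S` has an obstructing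
prime in `P` (`tr(a(σ)ρ̄(σ)) ≠ 0` for every arithmetic Frobenius `σ` above it) and (H2)
`tr ρ₁(σ) = tr ρ₂(σ)` for every arithmetic Frobenius `σ` above every `p ∈ P`: THEN `ρ₁ ≃ ρ₂` in
the sense of Def 2.1.1 (`GL₄(ℤ₂)`-conjugate). A certificate supplies `S`, `ρ̄` (through its
fixed field `K`), the exhaustive enumeration behind (H1) (Steps 2–4: class field theory over the
core-free subextension, Thms 5.3.1/5.3.3, obstructing cycle types) and the finitely many trace
equalities (H2) (Step 5). Users take `(h : faltingsSerre_GSp4_two)` as a hypothesis.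
[cite: BrumerEtAl2019, Thm 2.1.5 and Alg 2.4.1] -/
def faltingsSerre_GSp4_two : Prop :=
  ∀ (S P : Finset ℕ) (ρ₁ ρ₂ : FramedGaloisRep ℚ ℤ_[2] 4) (ρbar : FramedGaloisRep ℚ (ZMod 2) 4),
    2 ∈ S → (∀ p ∈ P, p.Prime ∧ p ∉ S) →
    -- `ρ₁, ρ₂ : Gal_{ℚ,S} → GSp₄(ℤ₂)` with the same similitude character
    HaveSameSimilitude ρ₁ ρ₂ →
    IsUnramifiedOutsidePrimes S ρ₁ → IsUnramifiedOutsidePrimes S ρ₂ →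
    -- common residual representation `ρ̄ = ρ₁ mod 2 = ρ₂ mod 2`, absolutely irreducible
    (∀ σ, (ρbar σ).val = ((ρ₁ σ).val).map (PadicInt.toZMod (p := 2))) →
    (∀ σ, (ρbar σ).val = ((ρ₂ σ).val).map (PadicInt.toZMod (p := 2))) →
    FramedRep.IsAbsolutelyIrreducible ρbar →
    -- (H1) `P` obstructs every obstructing pair `(L, φ)` extending `(K, ρ̄)`,
    -- `L` unramified away from `S`
    (∀ a : absoluteGaloisGroup ℚ → Matrix (Fin 4) (Fin 4) (ZMod 2),
      IsExtendingCocycle ρbar a → IsCocycleUnramifiedOutside S a → (∃ σ, utr ρbar a σ ≠ 0) →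
        ∃ p ∈ P, ∀ v : HeightOneSpectrum (𝓞 ℚ), ((p : ℕ) : 𝓞 ℚ) ∈ v.asIdeal →
          ∀ 𝔓 ∈ v.primesAbove, ∀ σ : absoluteGaloisGroup ℚ, IsArithFrobAt (𝓞 ℚ) σ 𝔓 →
            utr ρbar a σ ≠ 0) →
    -- (H2) traces agree at the Frobenius elements of the primes in `P`
    (∀ p ∈ P, ∀ v : HeightOneSpectrum (𝓞 ℚ), ((p : ℕ) : 𝓞 ℚ) ∈ v.asIdeal →
      ∀ 𝔓 ∈ v.primesAbove, ∀ σ : absoluteGaloisGroup ℚ, IsArithFrobAt (𝓞 ℚ) σ 𝔓 →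
        Matrix.trace (ρ₁ σ).val = Matrix.trace (ρ₂ σ).val) →
    -- conclusion: `ρ₁ ≃ ρ₂` (Def 2.1.1)
    ∃ g : GL (Fin 4) ℤ_[2], ∀ σ, ρ₁ σ = g * ρ₂ σ * g⁻¹

end BrumerEtAl2019

/-- Unpacking lemma: under the criterion, the data of a certificate, (H1) and (H2), give the
`GL₄(ℤ₂)`-equivalence of the two `2`-adic representations. [cite: BrumerEtAl2019, Alg 2.4.1] -/
theorem BrumerEtAl2019.faltingsSerre_GSp4_two.equiv (h : BrumerEtAl2019.faltingsSerre_GSp4_two)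
    {S P : Finset ℕ} {ρ₁ ρ₂ : FramedGaloisRep ℚ ℤ_[2] 4} {ρbar : FramedGaloisRep ℚ (ZMod 2) 4}
    (hS : 2 ∈ S) (hP : ∀ p ∈ P, p.Prime ∧ p ∉ S)
    (hsim : BrumerEtAl2019.HaveSameSimilitude ρ₁ ρ₂)
    (hur₁ : BrumerEtAl2019.IsUnramifiedOutsidePrimes S ρ₁)
    (hur₂ : BrumerEtAl2019.IsUnramifiedOutsidePrimes S ρ₂)
    (hred₁ : ∀ σ, (ρbar σ).val = ((ρ₁ σ).val).map (PadicInt.toZMod (p := 2)))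
    (hred₂ : ∀ σ, (ρbar σ).val = ((ρ₂ σ).val).map (PadicInt.toZMod (p := 2)))
    (hirr : FramedRep.IsAbsolutelyIrreducible ρbar)
    (H1 : ∀ a : absoluteGaloisGroup ℚ → Matrix (Fin 4) (Fin 4) (ZMod 2),
      BrumerEtAl2019.IsExtendingCocycle ρbar a → BrumerEtAl2019.IsCocycleUnramifiedOutside S a →
        (∃ σ, BrumerEtAl2019.utr ρbar a σ ≠ 0) →
        ∃ p ∈ P, ∀ v : HeightOneSpectrum (𝓞 ℚ), ((p : ℕ) : 𝓞 ℚ) ∈ v.asIdeal →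
          ∀ 𝔓 ∈ v.primesAbove, ∀ σ : absoluteGaloisGroup ℚ, IsArithFrobAt (𝓞 ℚ) σ 𝔓 →
            BrumerEtAl2019.utr ρbar a σ ≠ 0)
    (H2 : ∀ p ∈ P, ∀ v : HeightOneSpectrum (𝓞 ℚ), ((p : ℕ) : 𝓞 ℚ) ∈ v.asIdeal →
      ∀ 𝔓 ∈ v.primesAbove, ∀ σ : absoluteGaloisGroup ℚ, IsArithFrobAt (𝓞 ℚ) σ 𝔓 →
        Matrix.trace (ρ₁ σ).val = Matrix.trace (ρ₂ σ).val) :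
    ∃ g : GL (Fin 4) ℤ_[2], ∀ σ, ρ₁ σ = g * ρ₂ σ * g⁻¹ :=
  h S P ρ₁ ρ₂ ρbar hS hP hsim hur₁ hur₂ hred₁ hred₂ hirr H1 H2

/-- Sanity check on the vocabulary: the zero cochain is an extending cocycle for any `ρ̄` (it is
the split pair `φ₀ = (ρ̄ 0; 0 ρ̄)` of Prop 2.3.14(b)) and it is not obstructing.
[cite: BrumerEtAl2019, Prop 2.3.14] -/
theorem BrumerEtAl2019.isExtendingCocycle_zero (ρbar : FramedGaloisRep ℚ (ZMod 2) 4) :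
    BrumerEtAl2019.IsExtendingCocycle ρbar (fun _ => 0) ∧
      ∀ σ, BrumerEtAl2019.utr ρbar (fun _ => 0) σ = 0 := by
  refine ⟨⟨continuous_const, fun σ τ => by simp, fun σ => ?_⟩, fun σ => by
    simp [BrumerEtAl2019.utr]⟩
  simp [BrumerEtAl2019.IsSp4Lie]


/-! ### Reduction to the abstract criterion `FaltingsSerre.traceEq_of_faltingsSerre_symplectic`

The Galois-specialised named fact `BrumerEtAl2019.faltingsSerre_GSp4_two` above is a COROLLARY
of the abstract (arbitrary topological group `Γ`, arbitrary "inertia set" `I` and "Frobenius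
set" `T`) typing `Literature.NumberTheory.FaltingsSerre.traceEq_of_faltingsSerre_symplectic`
of the same printed theorem (`Literature/NumberTheory/FaltingsSerre/Criterion.lean`), combined
with the tree's PROVED Carayol theorem
`exists_conj_eq_of_trace_eq_of_isAbsIrreducible_residual_holds` (traces `⇒` conjugacy) and the
PROVED existence of arithmetic Frobenius elements in `Gal(ℚ̄/ℚ)`
(`HeightOneSpectrum.exists_isArithFrobAt_of_mem_primesAbove_holds`).  We PROVE this reduction
(`BrumerEtAl2019.faltingsSerre_GSp4_two_of_traceEq`): with `Γ = Gal_ℚ`,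
`I = ⋃_{p ∉ S} ⋃_{𝔓 ∣ p} I_𝔓`, `T = {arithmetic Frobenius σ at 𝔓 ∣ p, p ∈ P}`, `J = J4`, and the
multiplier function chosen from `HaveSameSimilitude`, the binders of the abstract criterion are
exactly (H1), (H2) and the unramifiedness hypotheses; so the two typings of [BrumerEtAl2019,
Thm 2.1.5 / Alg 2.4.1] in the tree agree, and a proof of the abstract one discharges this one. -/

namespace BrumerEtAl2019

/-- `J4ᵀ = -J4`. [cite: BrumerEtAl2019, §4.2] -/
theorem J4_transpose (R : Type*) [CommRing R] : (J4 R).transpose = -J4 R := by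
  ext i j; fin_cases i <;> fin_cases j <;> simp [J4]

/-- `J4` has zero diagonal (it is alternating). [cite: BrumerEtAl2019, §4.2] -/
theorem J4_apply_diag (R : Type*) [CommRing R] (i : Fin 4) : J4 R i i = 0 := by
  fin_cases i <;> simp [J4]

/-- `J4² = -1`. [cite: BrumerEtAl2019, §4.2] -/
theorem J4_mul_J4 (R : Type*) [CommRing R] : J4 R * J4 R = -1 := by
  ext i j
  fin_cases i <;> fin_cases j <;>
    simp [J4, Matrix.mul_apply, Fin.sum_univ_four]

/-- `det J4` is a unit (indeed `(det J4)² = det(-1) = 1`). [cite: BrumerEtAl2019, §4.2] -/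
theorem isUnit_det_J4 (R : Type*) [CommRing R] : IsUnit (J4 R).det := by
  have h : (J4 R).det * (J4 R).det = 1 := by
    rw [← Matrix.det_mul, J4_mul_J4, Matrix.det_neg, Matrix.det_one]
    norm_num [Fintype.card_fin]
  exact IsUnit.of_mul_eq_one _ h

/-- `J4` is compatible with change of scalars (its entries are `0, ±1`).
[cite: BrumerEtAl2019, §4.2] -/
theorem J4_map {R S : Type*} [CommRing R] [CommRing S] (f : R →+* S) :
    (J4 R).map f = J4 S := by
  ext i j; fin_cases i <;> fin_cases j <;> simp [J4]

/-- The residue map of `ℤ₂` followed by Mathlib's identification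
`PadicInt.residueField : ResidueField ℤ_[p] ≃+* ZMod p` is `PadicInt.toZMod`. [folklore] -/
theorem residueField_residue (p : ℕ) [Fact p.Prime] (x : ℤ_[p]) :
    PadicInt.residueField (IsLocalRing.residue ℤ_[p] x) = PadicInt.toZMod x := rfl

/-- **The Galois-specialised criterion follows from the abstract one.**  From
`FaltingsSerre.traceEq_of_faltingsSerre_symplectic` (the typing of [BrumerEtAl2019, Thm 2.1.5 /
Alg 2.4.1 / Rem 2.4.2] for an arbitrary topological group with chosen inertia and Frobenius
sets), the Carayol theorem PROVED in the tree
(`exists_conj_eq_of_trace_eq_of_isAbsIrreducible_residual_holds`) and the existence of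
arithmetic Frobenius elements (`HeightOneSpectrum.exists_isArithFrobAt_of_mem_primesAbove_holds`)
we get `faltingsSerre_GSp4_two`: take `Γ = Gal_ℚ`, `I` = the union of the inertia groups above
the primes outside `S`, `T` = the arithmetic Frobenius elements above the primes of `P`,
`J = J4`. [cite: BrumerEtAl2019, Thm 2.1.5 and Alg 2.4.1] -/
theorem faltingsSerre_GSp4_two_of_traceEq
    (hFS : FaltingsSerre.traceEq_of_faltingsSerre_symplectic) : faltingsSerre_GSp4_two := by
  intro S P ρ₁ ρ₂ ρbar _hS hP hsim hur₁ hur₂ hred₁ hred₂ hirr H1 H2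
  classical
  -- the residual representations, as homomorphisms `Gal_ℚ →* GL₄(𝔽₂)`, are both `ρ̄`
  have hres₁ : FaltingsSerre.residual (ρ₁ : absoluteGaloisGroup ℚ →* GL (Fin 4) ℤ_[2]) =
      (ρbar : absoluteGaloisGroup ℚ →* GL (Fin 4) (ZMod 2)) :=
    MonoidHom.ext fun σ => Units.ext (by
      rw [FaltingsSerre.residual_apply_coe]; exact (hred₁ σ).symm)
  have hres₂ : FaltingsSerre.residual (ρ₂ : absoluteGaloisGroup ℚ →* GL (Fin 4) ℤ_[2]) =
      (ρbar : absoluteGaloisGroup ℚ →* GL (Fin 4) (ZMod 2)) :=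
    MonoidHom.ext fun σ => Units.ext (by
      rw [FaltingsSerre.residual_apply_coe]; exact (hred₂ σ).symm)
  have hirr' : IsAbsIrreducible (ρbar : absoluteGaloisGroup ℚ →* GL (Fin 4) (ZMod 2)) :=
    (FramedRep.isAbsolutelyIrreducible_iff_coe ρbar).1 hirr
  -- the multiplier function
  choose ν hν using hsim
  -- the inertia set `I` and the Frobenius set `T`
  let I : Set (absoluteGaloisGroup ℚ) := {σ | ∃ p : ℕ, p.Prime ∧ p ∉ S ∧
    ∃ v : HeightOneSpectrum (𝓞 ℚ), ((p : ℕ) : 𝓞 ℚ) ∈ v.asIdeal ∧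
      ∃ 𝔓 ∈ v.primesAbove, σ ∈ 𝔓.inertia (absoluteGaloisGroup ℚ)}
  let T : Set (absoluteGaloisGroup ℚ) := {σ | ∃ p ∈ P,
    ∃ v : HeightOneSpectrum (𝓞 ℚ), ((p : ℕ) : 𝓞 ℚ) ∈ v.asIdeal ∧
      ∃ 𝔓 ∈ v.primesAbove, IsArithFrobAt (𝓞 ℚ) σ 𝔓}
  -- Step A: the abstract criterion gives equality of all traces
  have htr : ∀ σ : absoluteGaloisGroup ℚ,
      ((ρ₁ : absoluteGaloisGroup ℚ →* GL (Fin 4) ℤ_[2]) σ : Matrix (Fin 4) (Fin 4) ℤ_[2]).trace =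
        ((ρ₂ : absoluteGaloisGroup ℚ →* GL (Fin 4) ℤ_[2]) σ :
          Matrix (Fin 4) (Fin 4) ℤ_[2]).trace := by
    refine hFS 2 (absoluteGaloisGroup ℚ) 4 (ρ₁ : absoluteGaloisGroup ℚ →* GL (Fin 4) ℤ_[2])
      (ρ₂ : absoluteGaloisGroup ℚ →* GL (Fin 4) ℤ_[2]) (map_continuous ρ₁) (map_continuous ρ₂)
      I T (J4 ℤ_[2]) (isUnit_det_J4 _) (J4_transpose _) (J4_apply_diag _)
      (fun σ => (ν σ : ℤ_[2])) (fun σ => (hν σ).1) (fun σ => (hν σ).2) (hres₁.trans hres₂.symm)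
      (hres₁ ▸ hirr') ?_ ?_ ?_
    · -- `ρ₁, ρ₂` are trivial on `I` (unramified outside `S`)
      rintro σ ⟨p, hp, hpS, v, hv, 𝔓, h𝔓, hσ⟩
      exact ⟨hur₁ p hp hpS v hv 𝔓 h𝔓 σ hσ, hur₂ p hp hpS v hv 𝔓 h𝔓 σ hσ⟩
    · -- completeness of `T` for the obstructing cocycles: this is (H1)
      intro μ hlc hμI hval hcoc hobs
      rw [hres₁] at hcoc hobs
      have hext : IsExtendingCocycle ρbar μ := by
        refine ⟨hlc.continuous, fun σ τ => hcoc σ τ, fun σ => ?_⟩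
        have hσ := hval σ
        rw [J4_map, FaltingsSerre.mem_spLie_iff] at hσ
        exact hσ
      have hunr : IsCocycleUnramifiedOutside S μ :=
        fun p hp hpS v hv 𝔓 h𝔓 σ hσ => hμI σ ⟨p, hp, hpS, v, hv, 𝔓, h𝔓, hσ⟩
      have hob : ∃ σ, utr ρbar μ σ ≠ 0 := by
        obtain ⟨σ, hσ⟩ := hobs
        exact ⟨σ, hσ⟩
      obtain ⟨p, hpP, hp⟩ := H1 μ hext hunr hob
      -- a finite place `v` of `ℚ` above `p` (the maximal ideal `(p)` of `𝓞 ℚ ≃ ℤ`)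
      obtain ⟨v, hv⟩ : ∃ v : HeightOneSpectrum (𝓞 ℚ), ((p : ℕ) : 𝓞 ℚ) ∈ v.asIdeal := by
        have hp' : p.Prime := (hP p hpP).1
        have hnu : ¬ IsUnit ((p : ℕ) : 𝓞 ℚ) := by
          intro h
          have h' := h.map Rat.ringOfIntegersEquiv
          rw [map_natCast, Int.isUnit_iff_natAbs_eq, Int.natAbs_natCast] at h'
          exact hp'.one_lt.ne' h'
        obtain ⟨M, hM, hle⟩ := Ideal.exists_le_maximal (Ideal.span {((p : ℕ) : 𝓞 ℚ)})
          (by rwa [Ne, Ideal.span_singleton_eq_top])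
        have hpM : ((p : ℕ) : 𝓞 ℚ) ∈ M := hle (Ideal.mem_span_singleton_self _)
        refine ⟨⟨M, hM.isPrime, fun hbot => ?_⟩, hpM⟩
        rw [hbot, Ideal.mem_bot] at hpM
        exact hp'.ne_zero (by exact_mod_cast hpM)
      obtain ⟨𝔓, h𝔓⟩ := v.primesAbove_nonempty
      obtain ⟨σ, hσ⟩ := HeightOneSpectrum.exists_isArithFrobAt_of_mem_primesAbove_holds h𝔓
      refine ⟨σ, ⟨p, hpP, v, hv, 𝔓, h𝔓, hσ⟩, ?_⟩
      rw [hres₁]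
      exact hp v hv 𝔓 h𝔓 σ hσ
    · -- traces agree on `T`: this is (H2)
      rintro σ ⟨p, hpP, v, hv, 𝔓, h𝔓, hσ⟩
      exact H2 p hpP v hv 𝔓 h𝔓 σ hσ
  -- Step B: Carayol (traces ⇒ conjugacy), residual irreducibility moved along
  -- `ResidueField ℤ₂ ≃ 𝔽₂`
  have hirr₂ : IsAbsIrreducible ((Matrix.GeneralLinearGroup.map (IsLocalRing.residue ℤ_[2])).comp
      (ρ₂ : absoluteGaloisGroup ℚ →* GL (Fin 4) ℤ_[2])) := by
    intro k' _ f
    have key : (Matrix.GeneralLinearGroup.map f).comp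
        ((Matrix.GeneralLinearGroup.map (IsLocalRing.residue ℤ_[2])).comp
          (ρ₂ : absoluteGaloisGroup ℚ →* GL (Fin 4) ℤ_[2])) =
        (Matrix.GeneralLinearGroup.map
          (f.comp (PadicInt.residueField (p := 2)).symm.toRingHom)).comp
          (ρbar : absoluteGaloisGroup ℚ →* GL (Fin 4) (ZMod 2)) := by
      refine MonoidHom.ext fun σ => Units.ext (Matrix.ext fun i j => ?_)
      change f (IsLocalRing.residue ℤ_[2] ((ρ₂ σ).val i j)) =
        f ((PadicInt.residueField (p := 2)).symm ((ρbar σ).val i j))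
      rw [hred₂ σ, Matrix.map_apply, ← residueField_residue, RingEquiv.symm_apply_apply]
    rw [key]
    exact hirr' k' _
  obtain ⟨g, hg⟩ := exists_conj_eq_of_trace_eq_of_isAbsIrreducible_residual_holds ℤ_[2]
    (absoluteGaloisGroup ℚ) 4 (ρ₂ : absoluteGaloisGroup ℚ →* GL (Fin 4) ℤ_[2])
    (ρ₁ : absoluteGaloisGroup ℚ →* GL (Fin 4) ℤ_[2]) hirr₂ htr
  exact ⟨g, fun σ => hg σ⟩

end BrumerEtAl2019

end Literature.NumberTheory.GaloisRepresentations
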